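import Literature.AnabelianGeometry.AbsoluteAnabelian.MonoidKummerTransport
import Literature.AnabelianGeometry.AbsoluteAnabelian.MonoidKummerModelCompactProofs

/-!
# [AbsTopIII] Prop 3.2 (ii): Kummer-faithfulness of an arbitrary MLF-Galois `TM`-pair with compact `Π`

Proof-only companion (no definitions) of `MonoidKummerTransport.lean` (seat abc-iut-L4-t2; S. Mochizuki,
*Topics in absolute anabelian geometry III*, §3, Prop. 3.2 (ii)(iii)(v) pp. 71–72; cone rows
AbsTopIII:Prop3.2(ii)/(iii)/(v)).  The transported Kummer theory of `MonoidKummerTransport` is not only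
INHABITED (which, for a structure whose Kummer fields carry laws but no injectivity clause, is weak
evidence — cf. finding F-w5d049-1 on `UnitKummerTheory`) but KUMMER-FAITHFUL:

* `MonoidKummerTheory.transport_kummer_injective` — injectivity of `κ_H` is preserved by transport along
  an isomorphism of pairs;
* **`exists_monoidKummerTheory_recoversClosure_injective`** — for every MLF-Galois `TM`-pair `(Π ↷ M)`
  with COMPACT `Π` there is a Kummer theory recovering `k̄ ⊇ 𝒪_k̄^⊳ ≅ M` whose Kummer maps
  `M^H → H¹(H, μ)` are INJECTIVE at every open `H ⊆ Π` ("Kummer-faithfulness"; the model theorem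
  `ModelMLFGaloisData.kummer_injective_of_compactSpace`, seat abc-iut-L4-t2 gen 2, transported).

HONEST FRAMING: as in `MonoidKummerTransport` — existence by transport from the model; the
group-theoretic reconstruction of the field (Cor. 1.10 (h)) is a FACT-policy input and is not claimed.
Nothing here bears on [IUTchIII] Cor. 3.12.
-/

noncomputable section

universe u

namespace Literature.AnabelianGeometry.AbsoluteAnabelian

namespace MonoidKummerTheory

variable {P Q : GaloisMonoidPair.{u}}

/-- **Injectivity of the Kummer map is preserved by transport**: if `κ_{e_Π⁻¹ H'}` of `T` is injective,
so is `κ_{H'}` of `T.transport e` (it is `κ_{e_Π⁻¹ H'} ∘ e_M⁻¹`).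
[cite: MochizukiAbsTopIII2015, Proposition 3.2 (ii) p.71] -/
theorem transport_kummer_injective (T : MonoidKummerTheory P) (e : GaloisMonoidPair.Iso P Q)
    (H : OpenSubgroup Q.Pi)
    (h : Function.Injective (T.kummer (H.comap e.isoPi.toMonoidHom e.isoPi.continuous))) :
    Function.Injective ((T.transport e).kummer H) := by
  intro m m' hmm'
  rw [transport_kummer, transport_kummer] at hmm'
  have h1 := congrArg Subtype.val (h hmm')
  exact Subtype.ext (e.isoM.symm.injective h1)

end MonoidKummerTheory

/-- Compactness of `Π` is transported along an isomorphism of pairs.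
[cite: MochizukiAbsTopIII2015, Definition 3.1 (ii) p.67] -/
theorem GaloisMonoidPair.Iso.compactSpace_of_compactSpace {P Q : GaloisMonoidPair.{u}}
    (e : GaloisMonoidPair.Iso P Q) [CompactSpace Q.Pi] : CompactSpace P.Pi :=
  e.isoPi.toHomeomorph.symm.compactSpace

/-- **Prop 3.2 (ii)(iii)(v) with Kummer-faithfulness, for every MLF-Galois `TM`-pair with compact
Galois group**: there are model data, an isomorphism `e : (Π_k ↷ 𝒪_k̄^⊳) ⥲ P` and a Kummer theory `T`
on `P` recovering the closure (`T.F = k̄`, `M ↦ 𝒪_k̄^⊳ ⊆ k̄` along `e⁻¹`) whose Kummer maps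
`M^H → H¹(H, μ)` are injective at EVERY open subgroup `H ⊆ Π`.
[cite: MochizukiAbsTopIII2015, Proposition 3.2 (ii) p.71] -/
theorem exists_monoidKummerTheory_recoversClosure_injective (P : GaloisMonoidPair.{0})
    (hP : IsMLFGaloisMonoidPair .TM P) [CompactSpace P.Pi] :
    ∃ (C : MLFClosure.{0}) (D : ModelMLFGaloisData C.k C.K) (e : GaloisMonoidPair.Iso D.tmPair P)
      (T : MonoidKummerTheory P),
      T.RecoversClosure C (fun m => ((e.isoM.symm m : D.tmPair.M) : C.K)) ∧
        ∀ H : OpenSubgroup P.Pi, Function.Injective (T.kummer H) := by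
  obtain ⟨C, D, Q₀, hQ₀, ⟨e⟩⟩ := hP.exists_model
  have hQ' : D.tmPair = Q₀ := Option.some_injective _ (D.monoidPair_TM.symm.trans hQ₀)
  subst hQ'
  haveI : CompactSpace D.Pi := e.compactSpace_of_compactSpace
  exact ⟨C, D, e, (D.kummerTheory C).transport e, (D.kummerTheory_recoversClosure C).transport e,
    fun H => MonoidKummerTheory.transport_kummer_injective _ e H
      (D.kummer_injective_of_compactSpace C _)⟩

end Literature.AnabelianGeometry.AbsoluteAnabelian

end
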